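import Literature.NumberTheory.LFunctions.KhaleLemma62
import Literature.NumberTheory.LFunctions.VinogradovKorobovNearZeroCount
import Literature.NumberTheory.LFunctions.VinogradovKorobovCotBound
import HarnessLib

/-!
# Khale 2024, Lemma 6.3: zeros of `L(s, χ)` near `1 + it` — with the constant that the printed argument yields

Topic `Literature/NumberTheory/LFunctions`.  Everything in this file is PROVED; the only `def`s are
`KhaleL63.nearZeros χ t R` (the zeros `ρ` of `L(·, χ)` with `|1 + it − ρ| ≤ R`) and the count
`KhaleL63.khaleN χ t R = N_χ(t, R)` (with multiplicity, read in `ℝ`); no named fact.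

**Lemma 6.3 of T. Khale, *An explicit Vinogradov–Korobov zero-free region for Dirichlet
L-functions*, Q. J. Math. 75 (2024) = arXiv:2210.06457v1 (pp. 12–13):**

> Assume (2.4) with `A, B > 0`. Let `q ≥ 3`, `χ` (mod `q`). If `1.04(log(t/100))^{−2/3} ≤ R ≤ 1/4`
> and `t ≥ max{e^{1938}, q^{1/100000}}`, then
> `N_χ(t, R) ≤ 1.3478 R^{3/2} B log t + 0.49 + (log(A+1) − log R + 1.8579 R log q + ⅔ log log t)/1.879`.

## The constant: `3.777`, not the printed `0.49`

The printed proof ("Apply Lemma 6.2 with `s = 1 + 0.6421R + it`, `η = 2.5R` … By Lemma 4.1,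
`|L'/L(s + η + iv)| ≤ 1/(3.1421R)` (6.1) … it follows from (6.1), (6.2), and Lemma 6.2 that
`−1/(3.1421R) ≤ −0.3758 N_χ(t,R)/R + (1/5R)(…)`") repeats K. Ford, *Zero-free regions for the
Riemann zeta function* (2002), proof of Lemma 4.2, including its slip, already recorded on the `ζ`
side of the tree (`VinogradovKorobovNearZeroCount.lean`, `mty_lemma_4_5_of_ford41`): the left-hand
side of Lemma 6.2 is `−Re L'/L(s)` on the line `Re s = 1 + 0.6421R`, where Lemma 4.1 only gives
`|L'/L(s)| < 1/(0.6421R)`; the bound `1/(3.1421R)` of (6.1) holds on `Re = 1 + 3.1421R`, the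
abscissa of the log-integral.  What the printed argument proves is the lemma with
`(1/0.3758)(1/0.6421 − 0.6903/5) = 3.7768… ≤ 3.777` in place of `0.49` (using, as on the `ζ` side,
Ramaré's `ζ(σ) ≤ e^{γ(σ−1)}/(σ−1)` for `log ζ(1 + 3.1421R) ≤ −log R − 0.6903`; the source's
"`ζ(1 + 3.1421R) ≤ 0.6 + 1/(3.1421R)`" invokes Lemma 4.1 outside its range `σ ≤ 1.06`).  This is
the statement proved below, for every non-principal `χ` (the case covered by the tree's Lemma 6.2);
the printed statement may still be true — this file does not decide that.  Downstream (Lemma 6.4,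
Lemma 9.1, §10) the constant enters as `0.49 − 1/(2·1.879) = 0.224`; see the folder notes of the
unit `Khale2024_zeroFreeRegion` for the (uncertified) effect on Theorem 1.1.

## Proof (Ford's, with the honest constant; port of `mty_lemma_4_5_of_ford41`)

`σ = 1 + 0.6421R`, `η = 2.5R`, `S` = the zeros of the closed disc `|1 + it − ρ| ≤ R` (they have
`Re ρ ≥ 1 − R ≥ σ − η`): the left side of Lemma 6.2 is `≥ −1/(0.6421R)`
(`KhaleL41.norm_logDeriv_LFunction_lt`); for `ρ` in the disc, `z = (s − ρ)/R ∈ U` and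
`(π/2η)cot(π(s−ρ)/2η) = R⁻¹(π/5)cot(πz/5)`, so the cot-sum is `≥ 0.3758 N/R` (Ford's (4.2) =
Khale's (6.2), the tree's certified `ford_re_cot_ge`); the log-integral is
`≥ −2 log ζ(1 + 3.1421R)` (`|L(s', χ)| ≥ 1/ζ(Re s')`, `KhaleL41.inv_re_riemannZeta_le_norm_LFunction`,
`∫ sech² = 2`), and `log ζ(1 + 3.1421R) ≤ −log R − 0.6903` (`NearZeroCount.log_zeta_ramare_bound`).

## References

* T. Khale, arXiv:2210.06457v1, Lemma 6.3 and its proof, (6.1)–(6.2) (pp. 12–13). [Khale2024]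
* K. Ford, *Zero-free regions for the Riemann zeta function* (2002) = arXiv:1910.08205, Lemmas
  3.1, 4.1, 4.2 and (4.1)–(4.2). [Ford2002Millennium]
-/

noncomputable section

open Complex Real MeasureTheory Finset Set Filter Metric
open scoped Topology
open Literature.Analysis.Complex Literature.Analysis.Complex.FordDetector

namespace Literature.NumberTheory.LFunctions

namespace KhaleL63

open DirichletDisc DirichletDetector NearZeroCount

variable {q : ℕ} [NeZero q]

/-- The zeros `ρ` of `L(·, χ)` with `|1 + it − ρ| ≤ r`, each listed once (a finite set for
`χ ≠ χ₀`, `DirichletDetector.finite_zeros_closedBall`; `∅` by convention should the set be infinite).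
[cite: Khale2024, §6 (N_χ(t, R))] -/
def nearZeros (χ : DirichletCharacter ℂ q) (t r : ℝ) : Finset ℂ :=
  open Classical in
  if h : {ρ : ℂ | ρ ∈ closedBall (1 + (t : ℂ) * I) r ∧ χ.LFunction ρ = 0}.Finite then h.toFinset else ∅

/-- **`N_χ(t, r)`**: the number of zeros `ρ` of `L(s, χ)` with `|1 + it − ρ| ≤ r`, counted with
multiplicity (`DirichletDisc.zeroOrder`), read in `ℝ`. [cite: Khale2024, §6 (N_χ(t, R))] -/
def khaleN (χ : DirichletCharacter ℂ q) (t r : ℝ) : ℝ :=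
  ∑ ρ ∈ nearZeros χ t r, (zeroOrder χ ρ : ℝ)

/-- Membership in `nearZeros` (`χ ≠ χ₀`). [folklore] -/
theorem mem_nearZeros {χ : DirichletCharacter ℂ q} (hχ : χ ≠ 1) {t r : ℝ} {ρ : ℂ} :
    ρ ∈ nearZeros χ t r ↔ χ.LFunction ρ = 0 ∧ ‖1 + t * I - ρ‖ ≤ r := by
  rw [nearZeros, dif_pos (finite_zeros_closedBall hχ _ _), Set.Finite.mem_toFinset, Set.mem_setOf_eq,
    mem_closedBall, dist_comm, dist_eq_norm, and_comm]

/-- `N_χ(t, r) ≥ 0`. [folklore] -/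
theorem khaleN_nonneg (χ : DirichletCharacter ℂ q) (t r : ℝ) : 0 ≤ khaleN χ t r :=
  Finset.sum_nonneg fun _ _ ↦ Nat.cast_nonneg _

/-- The log-integral on `Re = σ' > 1` is `≥ −2 log ζ(σ')` (`|L(s, χ)| ≥ 1/ζ(Re s)`).
[cite: Khale2024, Lemma 6.3 (proof, (6.1))] -/
theorem integral_log_norm_LFunction_ge (χ : DirichletCharacter ℂ q) {σ' : ℝ} (hσ : 1 < σ') (τ κ : ℝ) :
    -2 * Real.log ((riemannZeta σ').re) ≤
      ∫ u : ℝ, Real.log ‖χ.LFunction ((σ' : ℂ) + ((τ + u * κ : ℝ) : ℂ) * I)‖ / Real.cosh u ^ 2 := by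
  have hint := KhaleL71.integrable_log_norm_LFunction_line χ hσ τ κ
  have hint0 : Integrable fun u : ℝ ↦ (-Real.log ((riemannZeta σ').re)) * (1 / Real.cosh u ^ 2) :=
    (Literature.Analysis.SpecialFunctions.integrable_inv_cosh_sq).const_mul _
  have hmono := integral_mono hint0 hint fun u ↦ ?_
  · have e : ∫ u : ℝ, (-Real.log ((riemannZeta σ').re)) * (1 / Real.cosh u ^ 2)
        = -2 * Real.log ((riemannZeta σ').re) := by
      rw [MeasureTheory.integral_const_mul, Literature.Analysis.SpecialFunctions.integral_inv_cosh_sq]; ring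
    rw [e] at hmono
    exact hmono
  · simp only
    rw [show (-Real.log ((riemannZeta σ').re)) * (1 / Real.cosh u ^ 2)
        = (-Real.log ((riemannZeta σ').re)) / Real.cosh u ^ 2 by ring]
    refine div_le_div_of_nonneg_right ?_ (by positivity)
    -- `-log ζ(σ') ≤ log |L|`
    set s : ℂ := (σ' : ℂ) + ((τ + u * κ : ℝ) : ℂ) * I with hs
    have hsre : s.re = σ' := by simp [hs]
    have h1 := KhaleL41.inv_re_riemannZeta_le_norm_LFunction χ (s := s) (by rw [hsre]; exact hσ)
    rw [hsre] at h1
    have hZ : 0 < (riemannZeta σ').re := by linarith [one_le_re_zeta hσ]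
    have := Real.log_le_log (inv_pos.2 hZ) h1
    rwa [Real.log_inv] at this

set_option maxHeartbeats 800000 in
/-- **Khale 2024, Lemma 6.3, with the constant that the printed argument yields (`3.777` for
`0.49`), non-principal `χ`.** Assume (2.4) (`HasHurwitzFordBound A B`, `A, B > 0`), `q ≥ 3`,
`χ ≠ χ₀` mod `q`, `t ≥ e^{1938}`, `t ≥ q^{1/100000}`, `1.04(log(t/100))^{−2/3} ≤ R ≤ 1/4`. Then
`N_χ(t, R) ≤ 1.3478 R^{3/2} B log t + 3.777 + (log(A+1) − log R + 1.8579 R log q + ⅔ log log t)/1.879`.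
[cite: Khale2024, Lemma 6.3] -/
theorem lemma63 {A B : ℝ} (hA : 0 < A) (hB : 0 < B) (hF : HasHurwitzFordBound A B)
    (hq : 3 ≤ q) {χ : DirichletCharacter ℂ q} (hχ : χ ≠ 1) {t R : ℝ} (ht : Real.exp 1938 ≤ t)
    (htq : (q : ℝ) ^ (1 / 100000 : ℝ) ≤ t)
    (hRl : 1.04 * Real.log (t / 100) ^ (-(2 / 3 : ℝ)) ≤ R) (hR4 : R ≤ 1 / 4) :
    khaleN χ t R ≤ 1.3478 * R ^ (3 / 2 : ℝ) * B * Real.log t + 3.777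
      + (Real.log (A + 1) - Real.log R + 1.8579 * R * Real.log q + 2 / 3 * Real.log (Real.log t)) / 1.879 := by
  classical
  have ht6 : (10 : ℝ) ^ 6 ≤ t := KhaleL52.exp_1938_ge.trans ht
  have h6 : (10 : ℝ) ^ 6 = 1000000 := by norm_num
  have hX : 0 < Real.log (t / 100) ^ (-(2 / 3 : ℝ)) :=
    Real.rpow_pos_of_pos (Real.log_pos (by rw [lt_div_iff₀ (by norm_num)]; linarith)) _
  have hR : 0 < R := lt_of_lt_of_le (by positivity) hRl
  set σ : ℝ := 1 + 0.6421 * R with hσ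
  set η : ℝ := 5 / 2 * R with hη
  have hη0 : 0 < η := by positivity
  -- the disc zeros qualify
  have hmem : ∀ ρ ∈ nearZeros χ t R, χ.LFunction ρ = 0 ∧ σ - η ≤ ρ.re := by
    intro ρ hρ
    rw [mem_nearZeros hχ] at hρ
    have hre := Complex.abs_re_le_norm (1 + t * I - ρ)
    simp only [Complex.sub_re, Complex.add_re, Complex.one_re, Complex.mul_re, Complex.ofReal_re,
      Complex.I_re, mul_zero, Complex.ofReal_im, Complex.I_im, mul_one, sub_self, add_zero] at hre
    rw [abs_le] at hre
    refine ⟨hρ.1, ?_⟩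
    rw [hσ, hη]; linarith [hre.1, hre.2, hρ.2]
  have h := KhaleL62.lemma62 hA hB hF hq hχ (σ := σ) (t := t) (η := η) ht htq hη0
    (by rw [hη]; linarith) (by rw [hσ, hη]; linarith) (by rw [hσ]; linarith)
    (by rw [hσ, hη]; nlinarith) (by rw [hσ, hη]; linarith) (nearZeros χ t R) hmem
  -- (i) the left side `≥ −1/(0.6421R)`
  have hlhs : -(1 / (0.6421 * R)) ≤ -(deriv χ.LFunction (σ + t * I) / χ.LFunction (σ + t * I)).re := by
    have hs : 1 < ((σ : ℂ) + t * I).re := by simp [hσ]; positivity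
    have h1 := KhaleL41.norm_logDeriv_LFunction_lt χ (s := (σ : ℂ) + t * I) hs
    have e : ((σ : ℂ) + t * I).re - 1 = 0.6421 * R := by simp [hσ]
    rw [e] at h1
    have h2 := Complex.re_le_norm (deriv χ.LFunction (σ + t * I) / χ.LFunction (σ + t * I))
    linarith
  -- (ii) the cot terms: `Re h_η(ρ − s) ≤ −0.3758/R` on the disc
  have hcotρ : ∀ ρ ∈ nearZeros χ t R, (fordCot η (ρ - (σ + t * I))).re ≤ -(0.3758 / R) := by
    intro ρ hρ
    rw [mem_nearZeros hχ] at hρ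
    have hre1 : ρ.re < 1 := re_lt_one_of_LFunction_eq_zero hχ hρ.1
    set z : ℂ := ((σ : ℂ) + t * I - ρ) / (R : ℂ) with hz
    have hRC : (R : ℂ) ≠ 0 := by exact_mod_cast hR.ne'
    have ecoef : ((π / (2 * η) : ℝ) : ℂ) = ((1 / R : ℝ) : ℂ) * ((π / 5 : ℝ) : ℂ) := by
      rw [hη]; push_cast; field_simp
    have earg : ((π / (2 * η) : ℝ) : ℂ) * ((σ : ℂ) + t * I - ρ) = ((π / 5 : ℝ) : ℂ) * z := by
      rw [ecoef, hz]; push_cast; field_simp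
    have hzre : 0.6421 ≤ z.re := by
      rw [hz, Complex.div_ofReal_re]
      simp only [Complex.sub_re, Complex.add_re, Complex.ofReal_re, Complex.mul_re, Complex.I_re,
        mul_zero, Complex.ofReal_im, Complex.I_im, mul_one, sub_self, add_zero]
      rw [hσ, le_div_iff₀ hR]
      have hre := Complex.abs_re_le_norm (1 + t * I - ρ)
      simp only [Complex.sub_re, Complex.add_re, Complex.one_re, Complex.mul_re, Complex.ofReal_re,
        Complex.I_re, mul_zero, Complex.ofReal_im, Complex.I_im, mul_one, sub_self, add_zero] at hre
      rw [abs_le] at hre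
      nlinarith [hre.1, hre.2, hρ.2, hre1]
    have hznorm : ‖z - 0.6421‖ ≤ 1 := by
      have e : z - 0.6421 = (1 + t * I - ρ) / (R : ℂ) := by
        rw [hz, hσ]; push_cast; field_simp; ring
      rw [e, norm_div, Complex.norm_real, Real.norm_eq_abs, abs_of_pos hR, div_le_one hR]
      exact hρ.2
    have hc := ford_re_cot_ge z hzre hznorm
    -- `fordCot η (ρ − s) = −fordCot η (s − ρ)` and `fordCot η (s − ρ) = (1/R)(π/5)cot((π/5) z)`
    have eneg : fordCot η (ρ - (σ + t * I)) = -fordCot η ((σ : ℂ) + t * I - ρ) := by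
      rw [← fordCot_neg, neg_sub]
    have epos : (fordCot η ((σ : ℂ) + t * I - ρ)).re =
        1 / R * (((π / 5 : ℝ) : ℂ) * Complex.cot (((π / 5 : ℝ) : ℂ) * z)).re := by
      simp only [fordCot]
      rw [earg, ecoef, mul_assoc, Complex.re_ofReal_mul]
    rw [eneg, Complex.neg_re, epos, neg_le_neg_iff, div_eq_mul_one_div, mul_comm]
    exact mul_le_mul_of_nonneg_left hc (by positivity)
  have hsum : ∑ ρ ∈ nearZeros χ t R, (zeroOrder χ ρ : ℝ) * (fordCot η (ρ - (σ + t * I))).re ≤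
      -(0.3758 / R) * khaleN χ t R := by
    unfold khaleN
    rw [Finset.mul_sum]
    refine Finset.sum_le_sum fun ρ hρ ↦ ?_
    have hm : (0 : ℝ) ≤ zeroOrder χ ρ := Nat.cast_nonneg _
    rw [mul_comm (-(0.3758 / R))]
    exact mul_le_mul_of_nonneg_left (hcotρ ρ hρ) hm
  -- (iii) the integral term
  have hση : σ + η = 1 + 3.1421 * R := by rw [hσ, hη]; ring
  have hint : -(1 / (4 * η) * ∫ u : ℝ, Real.log ‖χ.LFunction ((σ + η : ℝ) +
        ((t + u * (2 * η / π) : ℝ) : ℂ) * I)‖ / Real.cosh u ^ 2)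
      ≤ 1 / (2 * η) * (-Real.log R - 0.6903) := by
    have h1 := integral_log_norm_LFunction_ge χ (σ' := σ + η) (by rw [hση]; linarith) t (2 * η / π)
    rw [hση] at h1 ⊢
    have h2 := log_zeta_ramare_bound hR hR4
    have h4η : 0 < 1 / (4 * η) := by positivity
    have e : 1 / (2 * η) = 2 * (1 / (4 * η)) := by field_simp; ring
    rw [e]
    nlinarith
  -- (iv) the Richert term: `(1 − σ + η)^{3/2} = (1.8579R)^{3/2} ≤ 2.5325 R^{3/2}`
  have hrich : 1 - σ + η = 1.8579 * R := by rw [hσ, hη]; ring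
  have hpow : (1 - σ + η) ^ (3 / 2 : ℝ) ≤ 2.5325 * R ^ (3 / 2 : ℝ) := by
    rw [hrich, Real.mul_rpow (by norm_num) hR.le]
    refine mul_le_mul_of_nonneg_right ?_ (by positivity)
    have e : (1.8579 : ℝ) ^ (3 / 2 : ℝ) = 1.8579 * Real.sqrt 1.8579 := by
      rw [show (3 / 2 : ℝ) = 1 + 1 / 2 by norm_num, Real.rpow_add (by norm_num), Real.rpow_one,
        Real.sqrt_eq_rpow]
    rw [e]
    have hs : Real.sqrt 1.8579 ≤ 1.36305 := by
      rw [Real.sqrt_le_left (by norm_num)]; norm_num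
    nlinarith [Real.sqrt_nonneg 1.8579]
  -- assemble: `0.3758 N/R ≤ 1/(0.6421R) + (1/(5R))(1.8579 R log q + 2/3 LL + 2.5325 B R^{3/2} L + log(A+1) − log R − 0.6903)`
  have hL : 0 ≤ Real.log t := Real.log_nonneg (by linarith)
  have hlogq : 0 ≤ Real.log (q : ℝ) := Real.log_natCast_nonneg q
  have h2η : 1 / (2 * η) = 1 / (5 * R) := by rw [hη]; ring
  have hkey : 0.3758 / R * khaleN χ t R ≤ 1 / (0.6421 * R)
      + 1 / (5 * R) * (1.8579 * R * Real.log q + 2 / 3 * Real.log (Real.log t)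
          + B * (2.5325 * R ^ (3 / 2 : ℝ)) * Real.log t + Real.log (A + 1))
      + 1 / (5 * R) * (-Real.log R - 0.6903) := by
    have hBt : B * (1 - σ + η) ^ (3 / 2 : ℝ) * Real.log t ≤ B * (2.5325 * R ^ (3 / 2 : ℝ)) * Real.log t :=
      mul_le_mul_of_nonneg_right (mul_le_mul_of_nonneg_left hpow hB.le) hL
    have h5R : 0 < 1 / (5 * R) := by positivity
    rw [h2η, hrich] at h
    rw [h2η] at hint
    rw [hrich] at hBt
    nlinarith [h, hlhs, hsum, hint, hBt, h5R]
  -- divide by `0.3758/R`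
  have hN0 := khaleN_nonneg χ t R
  have hR32 : 0 ≤ R ^ (3 / 2 : ℝ) := by positivity
  have e : (1 / (0.6421 * R)
      + 1 / (5 * R) * (1.8579 * R * Real.log q + 2 / 3 * Real.log (Real.log t)
          + B * (2.5325 * R ^ (3 / 2 : ℝ)) * Real.log t + Real.log (A + 1))
      + 1 / (5 * R) * (-Real.log R - 0.6903)) * (R / 0.3758)
      = (1 / 0.6421 - 0.6903 / 5) / 0.3758
        + (2.5325 / (5 * 0.3758)) * R ^ (3 / 2 : ℝ) * B * Real.log t
        + (Real.log (A + 1) - Real.log R + 1.8579 * R * Real.log q + 2 / 3 * Real.log (Real.log t))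
            / (5 * 0.3758) := by
    field_simp; ring
  have hmul := mul_le_mul_of_nonneg_right hkey (show (0 : ℝ) ≤ R / 0.3758 by positivity)
  rw [e, show 0.3758 / R * khaleN χ t R * (R / 0.3758) = khaleN χ t R by field_simp] at hmul
  have hc1 : (1 / 0.6421 - 0.6903 / 5) / 0.3758 ≤ (3.777 : ℝ) := by norm_num
  have hc2 : 2.5325 / (5 * 0.3758) * R ^ (3 / 2 : ℝ) * B * Real.log t ≤
      1.3478 * R ^ (3 / 2 : ℝ) * B * Real.log t := by
    have : 0 ≤ R ^ (3 / 2 : ℝ) * B * Real.log t := by positivity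
    have hc : (2.5325 / (5 * 0.3758) : ℝ) ≤ 1.3478 := by norm_num
    nlinarith
  have hc3 : (Real.log (A + 1) - Real.log R + 1.8579 * R * Real.log q + 2 / 3 * Real.log (Real.log t))
      / (5 * 0.3758)
      = (Real.log (A + 1) - Real.log R + 1.8579 * R * Real.log q + 2 / 3 * Real.log (Real.log t)) / 1.879 := by
    norm_num
  linarith

end KhaleL63

end Literature.NumberTheory.LFunctions
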